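import Summits.QuantumFields.YangMills.Theorems.BalabanUVNodesN07CritSelectiveCorrector
import Summits.QuantumFields.YangMills.Theorems.BalabanUVNodesN07CritMultiScaleOfCorrector
import Summits.QuantumFields.YangMills.Theorems.BalabanUVNodesN07CritTangentConverse

/-!
# NODE N07 ([15] = [Balaban1985Variational]) — MODULE 35j: THE MULTI-SCALE TANGENT AND CURRENT FORMS FOR CHAIN-FREE CONSTRAINT FAMILIES, NO CHART, NO CORRECTOR HYPOTHESIS
# (ascending-level exact correction by the selective `k`-fold corrector 35h; the multi-scale «curve-critical ⇒ (82)» whenever the central chains of the pinned bonds are free)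

Cell `pub-ymgap`, seat `pub-ymgap-dag-n07-e` generation 14 (R141 (C), DAG node N07).  `--kind proof --supports stmt-QuantumFields-20541 --as helper` (K0⁷; V18 stub 1
`stub_prop8StepCoP13` states criticality on the MULTI-SCALE fibre `AgreeOn (genSet s.Ω k) (Ū^·(U)) W` in the CURVE form `IsCritOnFibre`).

THE POINT.  35i isolated what separates stub 1's hypothesis from print's (82) on the multi-scale tangent space: a LOCAL CORRECTOR of the constraint at `U`; HOME
`LOCATED-MULTISCALE-FIBRE.md` § A located where the obvious one (correct each pinned bond through its own central chain) fails: at pins whose chain meets a LOWER pin.  Here the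
positive statement: for a CHAIN-FREE family — every level `ℓ` admits a tower through its pinned bonds, closed downwards under `centralBond`, disjoint from the pinned bonds of
every lower level (hypothesis `hCF`, spelled out; no definition) — the fibre has, along every joint-kernel ray, corrected curves with the prescribed velocity, built level by level
in ASCENDING order with 35h's selective corrector (each stage fixes level `ℓ` exactly, keeps the levels `< ℓ` by the off-tower clause and disjointness, and moves the configuration
by `O(defect) = o(t)`); hence curve-critical ⇒ tangent-critical on the joint kernel ⇒ the current form.  WHICH FAMILIES ARE CHAIN-FREE (width seat n07-w2's FINDING A, bus
2026-08-27 l.24275, with [15] p.277–278): under [15]'s own bond reading `Λ_j = bonds(Ω_j) ∖ bonds(Ω_{j+1})` (p.278 under (7): a bond with an end-point in the deeper region «does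
not belong to Λ_j») every pinned bond has an end-point in `Ω_j`, so every bond of its chain is unpinned at every lower level — chain-free; under the tree's `bondsOf` (bonds MEETING
`Γ_j`) the `Γ_j ↔ Ω_{j+1}` connectors are pinned too and their chains are not free (§ A; ROAD B of § B is the road there).  Which reading K0's statements carry is a statement-level
matter (plan ∕ r12); this module is stated for an ARBITRARY family through the tree's `AgreeOn 𝔹`, with chain-freeness as the hypothesis.

WHAT IS PROVED (sorry-free, no definition, axioms standard), every torus `P`, every `N`: §1 `hasDerivAt_coe_iter_apply_of_sameVelocity` (same base + same velocities ⇒ same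
derivative of every `Ū^k(·)(c)`, 35e), `isLittleO_norm_sub_of_sameVelocity`; §2 ★★ `exists_fibreCurve_succ_of_chainFree_step` (ONE ASCENDING STAGE: 35h + 35i §1), ★★★
`exists_fibreCurve_of_chainFree` (induction on the level from the ray); §3 at NODE 00's objects (`𝐁 : DetSet (F.P K)` through `bondsOf`, no member above `k₀ ≤ m + K`): ★★★
`hasDerivAt_wilsonAction4_expChart_of_isCritOnFibre_chainFree`, `deriv_…`, ★★★ `sum_re_trace_covDivT_eq_zero_of_isCritOnFibre_chainFree` (current form), `chainFree_atScale`
(the one-scale pin is chain-free: 35c recovered).  HONEST FRAMING: count-neutral kernel bookkeeping over 35e∕35h∕35i; smallness side conditions = the route `UnitScaleTilt`'s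
corrector's; chain-freeness of `genSet s.Ω k` under reading (b) is FALSE at crossing pins (§ A) and NOT claimed; nothing of [15] Sects. B–F; stub 1 ∕ K0⁷ NOT closed; N07 NOT
discharged (5∕27); one finite T⁴ programme at fixed ε — NOT continuum ∕ ℝ⁴ ∕ OS ∕ mass gap ∕ Clay.  No `sorry`, no `instance`, no `notation`.
References: T. Bałaban, CMP **102** (1985) 277–309 [Balaban1985Variational] (p.277, (3),(5)–(7) p.278, (47) p.285, (82)–(83) p.290, (141) p.299, p.300, Prop. 8 p.304);
CMP **109** (1987) 249–301 [Balaban1987RG1] ((0.4), (0.11) p.253); CMP **119** (1988) 243–285 [Balaban1988Convergent] ((2.2), (2.10)–(2.12) pp.255–256); CMP **99**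
(1985) 75–102 [Balaban1985RegularSpaces] ((1.1)–(1.2) p.76).
-/

noncomputable section

open scoped Matrix.Norms.L2Operator Topology BigOperators
open Filter Asymptotics Function NormedSpace

namespace Summit.QuantumFields.YangMills.BalabanUVNodes.N07CritMultiScaleChainFree

open Literature.MathematicalPhysics.QuantumFieldTheory.Balaban1983to89
open Literature.MathematicalPhysics.QuantumFieldTheory.Balaban1983to89.T4Continuum (T4Family)
open Literature.MathematicalPhysics.QuantumFieldTheory.Balaban1983to89.B15DeterminingSets
open Literature.MathematicalPhysics.QuantumFieldTheory.Balaban1983to89.BlockAveraging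
open Literature.MathematicalPhysics.QuantumFieldTheory.Balaban1983to89.BlockAveragingHaarAC (centralBond)
open Literature.MathematicalPhysics.QuantumFieldTheory.Balaban1983to89.BlockAveragingEMLHaarAC (emlWeight)
open Literature.MathematicalPhysics.QuantumFieldTheory.Balaban1983to89.ExpMeanLog (expMeanLogSU deltaSU deltaSU_pos)
open Literature.MathematicalPhysics.QuantumFieldTheory.Balaban1983to89.T4AdjointCovarianceUnitary (lieSU)
open Literature.MathematicalPhysics.QuantumFieldTheory.Balaban1983to89.B10Eq27TorusAxialLog (toUField unitsField)
open Literature.MathematicalPhysics.QuantumFieldTheory.Balaban1983to89.B10Eq68TorusRegularity (covDivT)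
open Literature.MathematicalPhysics.QuantumFieldTheory.Balaban1983to89.Node00
open Summit.QuantumFields.YangMills.Theorems.BlockAvgCorrector (stokesConst stokesConst_nonneg emlWeight_pos emlWeight_le_one)
open Summit.QuantumFields.YangMills.BalabanUVNodes.N07CritTangentAtRecord (tendsto_coeField_expChart_ray eventually_plaqSmall_iter_of_tendsto)
open Summit.QuantumFields.YangMills.BalabanUVNodes.N07CritTangentConverse (hasDerivAt_coeField_iter)
open Summit.QuantumFields.YangMills.BalabanUVNodes.N07CritSelectiveCorrector (exists_iter_eq_of_near_selective_SU_offTower)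
open Summit.QuantumFields.YangMills.BalabanUVNodes.N07CritMultiScaleOfCorrector (exists_curve_of_corrector)
open Summit.QuantumFields.YangMills.BalabanUVNodes.N07CritCurrentForm (sum_re_trace_covDivT_eq_zero_of_hasDerivAt_zero)

/-! ## §1  Same velocity ⇒ same derivative of every iterated average; `o(t)` distance -/

section SameVelocity

variable {P : Params} {N : ℕ} [NeZero N]

/-- **SAME BASE, SAME VELOCITIES ⇒ SAME DERIVATIVE OF `Ū^k(·)(c)`**: for two families `γ₁, γ₂` through `U` with bond-wise matrix velocities `Y` at `0` and `t₀`-small iterated averages of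
`U` below `k`, if `t ↦ Ū^k(γ₁ t)(c)` has derivative `v` at `0` then so has `t ↦ Ū^k(γ₂ t)(c)` (both equal the Fréchet derivative of 35b-i's `iterM k` at `↑U` on `Y`, 35e).
[cite: Balaban1987RG1, (0.4) p.253, (0.21) p.256; Balaban1985Variational, (83) p.290] -/
theorem hasDerivAt_coe_iter_apply_of_sameVelocity {t₀ : ℝ} (ht₀ : 0 < t₀) (hstδ : stokesConst P * t₀ < deltaSU (Fin N)) {U : GaugeField P 0 (SU N)}
    {γ₁ γ₂ : ℝ → GaugeField P 0 (SU N)} (h₁ : γ₁ 0 = U) (h₂ : γ₂ 0 = U) {Y : PBond P 0 → Matrix (Fin N) (Fin N) ℂ}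
    (hY₁ : ∀ b, HasDerivAt (fun t => ((γ₁ t b : SU N) : Matrix (Fin N) (Fin N) ℂ)) (Y b) 0)
    (hY₂ : ∀ b, HasDerivAt (fun t => ((γ₂ t b : SU N) : Matrix (Fin N) (Fin N) ℂ)) (Y b) 0) {k : ℕ}
    (hsm : ∀ i, i < k → PlaqSmall t₀ (Averaging.iter (fun i => blockAvg (P := P) (j := i) (expMeanLogSU (n := Fin N))) i U))
    {c : PBond P k} {v : Matrix (Fin N) (Fin N) ℂ}
    (hv : HasDerivAt (fun t => ((Averaging.iter (fun i => blockAvg (P := P) (j := i) (expMeanLogSU (n := Fin N))) k (γ₁ t) c : SU N) : Matrix (Fin N) (Fin N) ℂ)) v 0) :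
    HasDerivAt (fun t => ((Averaging.iter (fun i => blockAvg (P := P) (j := i) (expMeanLogSU (n := Fin N))) k (γ₂ t) c : SU N) : Matrix (Fin N) (Fin N) ℂ)) v 0 := by
  subst h₁
  have hπ₁ : HasDerivAt (fun t => coeField (γ₁ t)) Y 0 := hasDerivAt_pi.2 hY₁
  have hπ₂ : HasDerivAt (fun t => coeField (γ₂ t)) Y 0 := hasDerivAt_pi.2 hY₂
  have hD₁ := hasDerivAt_coeField_iter ht₀ hstδ hπ₁ (k := k) hsm
  have hD₂ := hasDerivAt_coeField_iter ht₀ hstδ hπ₂ (k := k) (by rw [h₂]; exact hsm)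
  rw [h₂] at hD₂
  have hc₁ := (hasDerivAt_pi.1 hD₁) c
  have hc₂ := (hasDerivAt_pi.1 hD₂) c
  have hveq : v = (fderiv ℝ (iterM k : (PBond P 0 → Matrix (Fin N) (Fin N) ℂ) → PBond P k → Matrix (Fin N) (Fin N) ℂ) (coeField (γ₁ 0))) Y c :=
    hv.unique hc₁
  rw [hveq]
  exact hc₂

omit [NeZero N] in
/-- Two bond matrices with the same value and the same derivative at `0` differ by an `o(t)` (in norm). [cite: Balaban1985Variational, (83) p.290 (bookkeeping)] -/
theorem isLittleO_norm_sub_of_sameVelocity {γ₁ γ₂ : ℝ → GaugeField P 0 (SU N)} (h0 : γ₁ 0 = γ₂ 0) {b : PBond P 0} {y : Matrix (Fin N) (Fin N) ℂ}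
    (h₁ : HasDerivAt (fun t => ((γ₁ t b : SU N) : Matrix (Fin N) (Fin N) ℂ)) y 0) (h₂ : HasDerivAt (fun t => ((γ₂ t b : SU N) : Matrix (Fin N) (Fin N) ℂ)) y 0) :
    (fun t => ‖((γ₁ t b : SU N) : Matrix (Fin N) (Fin N) ℂ) - (γ₂ t b : Matrix (Fin N) (Fin N) ℂ)‖) =o[𝓝 (0 : ℝ)] fun t => t := by
  have h : HasDerivAt (fun t => ((γ₁ t b : SU N) : Matrix (Fin N) (Fin N) ℂ) - (γ₂ t b : Matrix (Fin N) (Fin N) ℂ)) (y - y) 0 := h₁.sub h₂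
  rw [sub_self] at h
  have h' := hasDerivAt_iff_isLittleO.1 h
  simp only [h0, sub_self, sub_zero, smul_zero] at h'
  exact h'.norm_left

end SameVelocity

/-! ## §2  The ascending stage and the induction -/

section Ascend

variable {P : Params} {N : ℕ} [NeZero N]

/-- ★★ **ONE ASCENDING STAGE.**  From a curve through `U` with bond-wise velocity `U·X` agreeing with the datum on the levels `< ℓ` near `0` to one agreeing on the levels `≤ ℓ`,
given: `U` agrees with `W` on `Λ j`, `j ≤ ℓ`; `t₀`-small iterated averages below `ℓ ≤ m + K` (`stokesConst·t₀ < |I|⁻¹∕16`, `< δ_N`); a tower `T ⊇ Λ ℓ` closed downwards under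
`centralBond`, disjoint from `Λ j`, `j < ℓ`; `X` in the level-`ℓ` kernel.  At each good `t`: 35h's selective corrector at level `ℓ` on `γ t`, target «`W ℓ` on `Λ ℓ`, `Ū^ℓ(γ t)`
elsewhere» (exact at level `ℓ`; levels `< ℓ` kept off the tower, hence on `Λ j`; displacement `≤ (2∕|I|⁻¹)^ℓ ×` defect, an `o(t)` by §1); then 35i §1.
[cite: Balaban1985Variational, (3),(5) p.278, Sect. C (47) p.285, (82)–(83) p.290; Balaban1987RG1, (0.4), (0.11) p.253] -/
theorem exists_fibreCurve_succ_of_chainFree_step {t₀ : ℝ} (ht₀ : 0 < t₀) (hst : stokesConst P * t₀ < emlWeight P / 16)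
    (hstδ : stokesConst P * t₀ < deltaSU (Fin N)) {ℓ : ℕ} (hℓ : ℓ ≤ P.m + P.K)
    (Λ : (j : ℕ) → Set (PBond P j)) (W : (j : ℕ) → GaugeField P j (SU N)) {U : GaugeField P 0 (SU N)}
    (hsm : ∀ i, i < ℓ → PlaqSmall t₀ (Averaging.iter (fun i => blockAvg (P := P) (j := i) (expMeanLogSU (n := Fin N))) i U))
    (hfib : ∀ j, j ≤ ℓ → ∀ c ∈ Λ j, Averaging.iter (fun i => blockAvg (P := P) (j := i) (expMeanLogSU (n := Fin N))) j U c = W j c)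
    {T : (i : ℕ) → Set (PBond P i)} (hTΛ : Λ ℓ ⊆ T ℓ) (hT : ∀ i, i < ℓ → ∀ c : PBond P (i + 1), c ∈ T (i + 1) → centralBond c ∈ T i)
    (hTdisj : ∀ j, j < ℓ → Disjoint (T j) (Λ j))
    {X : PBond P 0 → lieSU (Fin N)}
    (hX : ∀ c ∈ Λ ℓ, HasDerivAt (fun t : ℝ => ((Averaging.iter (fun i => blockAvg (P := P) (j := i) (expMeanLogSU (n := Fin N))) ℓ
      (expChart U (t • X)) c : SU N) : Matrix (Fin N) (Fin N) ℂ)) 0 0)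
    {γ : ℝ → GaugeField P 0 (SU N)} (hγ0 : γ 0 = U)
    (hγvel : ∀ b : PBond P 0, HasDerivAt (fun t => ((γ t b : SU N) : Matrix (Fin N) (Fin N) ℂ)) ((U b : Matrix (Fin N) (Fin N) ℂ) * (X b : Matrix (Fin N) (Fin N) ℂ)) 0)
    (hγfib : ∀ᶠ t in 𝓝 (0 : ℝ), ∀ j, j < ℓ → ∀ c ∈ Λ j, Averaging.iter (fun i => blockAvg (P := P) (j := i) (expMeanLogSU (n := Fin N))) j (γ t) c = W j c) :
    ∃ γ' : ℝ → GaugeField P 0 (SU N), γ' 0 = U ∧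
      (∀ b : PBond P 0, HasDerivAt (fun t => ((γ' t b : SU N) : Matrix (Fin N) (Fin N) ℂ)) ((U b : Matrix (Fin N) (Fin N) ℂ) * (X b : Matrix (Fin N) (Fin N) ℂ)) 0) ∧
      ∀ᶠ t in 𝓝 (0 : ℝ), ∀ j, j ≤ ℓ → ∀ c ∈ Λ j, Averaging.iter (fun i => blockAvg (P := P) (j := i) (expMeanLogSU (n := Fin N))) j (γ' t) c = W j c := by
  classical
  set av : ∀ j, Averaging P j (SU N) := fun i => blockAvg (P := P) (j := i) (expMeanLogSU (n := Fin N)) with hav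
  set Γ₀ : ℝ → GaugeField P 0 (SU N) := fun t => expChart U (t • X) with hΓ₀
  have hΓ₀0 : Γ₀ 0 = U := by simp only [hΓ₀, zero_smul, expChart_zero]
  have hray : ∀ b, HasDerivAt (fun t : ℝ => ((Γ₀ t b : SU N) : Matrix (Fin N) (Fin N) ℂ))
      ((U b : Matrix (Fin N) (Fin N) ℂ) * (X b : Matrix (Fin N) (Fin N) ℂ)) 0 :=
    hasDerivAt_coe_expChart_along (U := U) (c := fun t : ℝ => t • X) (hasDerivAt_ray X) (zero_smul ℝ X)
  -- the level-`ℓ` defect of `γ t` and its distance to the ray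
  set D : GaugeField P 0 (SU N) → ℝ := fun V => ∑ c : PBond P ℓ,
    if c ∈ Λ ℓ then ‖((Averaging.iter av ℓ V c : SU N) : Matrix (Fin N) (Fin N) ℂ) - ((W ℓ c : SU N) : Matrix (Fin N) (Fin N) ℂ)‖ else 0 with hD
  set dist0 : ℝ → ℝ := fun t => ∑ b : PBond P 0, ‖((γ t b : SU N) : Matrix (Fin N) (Fin N) ℂ) - (Γ₀ t b : Matrix (Fin N) (Fin N) ℂ)‖ with hdist0
  have hterm_nonneg : ∀ (V : GaugeField P 0 (SU N)) (c : PBond P ℓ),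
      0 ≤ (if c ∈ Λ ℓ then ‖((Averaging.iter av ℓ V c : SU N) : Matrix (Fin N) (Fin N) ℂ) - ((W ℓ c : SU N) : Matrix (Fin N) (Fin N) ℂ)‖ else 0) := by
    intro V c
    split_ifs
    exacts [norm_nonneg _, le_rfl]
  have hD_nonneg : ∀ V, 0 ≤ D V := fun V => Finset.sum_nonneg fun c _ => hterm_nonneg V c
  have hdist0_nonneg : ∀ t, 0 ≤ dist0 t := fun t => Finset.sum_nonneg fun b _ => norm_nonneg _
  have hD_le : ∀ V {c : PBond P ℓ}, c ∈ Λ ℓ →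
      ‖((Averaging.iter av ℓ V c : SU N) : Matrix (Fin N) (Fin N) ℂ) - ((W ℓ c : SU N) : Matrix (Fin N) (Fin N) ℂ)‖ ≤ D V := by
    intro V c hc
    refine le_trans ?_ (Finset.single_le_sum (f := fun c : PBond P ℓ =>
      if c ∈ Λ ℓ then ‖((Averaging.iter av ℓ V c : SU N) : Matrix (Fin N) (Fin N) ℂ) - ((W ℓ c : SU N) : Matrix (Fin N) (Fin N) ℂ)‖ else 0)
      (fun c _ => hterm_nonneg V c) (Finset.mem_univ c))
    rw [if_pos hc]
  have hdist0_le : ∀ t b, ‖((γ t b : SU N) : Matrix (Fin N) (Fin N) ℂ) - (Γ₀ t b : Matrix (Fin N) (Fin N) ℂ)‖ ≤ dist0 t := fun t b =>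
    Finset.single_le_sum (f := fun b : PBond P 0 => ‖((γ t b : SU N) : Matrix (Fin N) (Fin N) ℂ) - (Γ₀ t b : Matrix (Fin N) (Fin N) ℂ)‖)
      (fun b _ => norm_nonneg _) (Finset.mem_univ b)
  -- `η := D ∘ γ + dist0` is an `o(t)` vanishing at `0`
  set η : ℝ → ℝ := fun t => D (γ t) + dist0 t with hη
  have hη_nonneg : ∀ t, 0 ≤ η t := fun t => add_nonneg (hD_nonneg _) (hdist0_nonneg t)
  have hη0 : η 0 = 0 := by
    have h1 : D (γ 0) = 0 := by
      rw [hγ0]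
      refine Finset.sum_eq_zero fun c _ => ?_
      split_ifs with hc
      · rw [hfib ℓ le_rfl c hc, sub_self, norm_zero]
      · rfl
    have h2 : dist0 0 = 0 := by
      refine Finset.sum_eq_zero fun b _ => ?_
      rw [hγ0, hΓ₀0, sub_self, norm_zero]
    show D (γ 0) + dist0 0 = 0
    rw [h1, h2, add_zero]
  have hDo : (fun t => D (γ t)) =o[𝓝 (0 : ℝ)] fun t => t := by
    have hterm : ∀ c : PBond P ℓ, (fun t : ℝ => if c ∈ Λ ℓ then ‖((Averaging.iter av ℓ (γ t) c : SU N) : Matrix (Fin N) (Fin N) ℂ) -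
        ((W ℓ c : SU N) : Matrix (Fin N) (Fin N) ℂ)‖ else 0) =o[𝓝 (0 : ℝ)] fun t => t := by
      intro c
      by_cases hc : c ∈ Λ ℓ
      · simp only [if_pos hc]
        -- the velocity of `Ū^ℓ(γ t)(c)` is that of the ray, i.e. `0`
        have hvel : HasDerivAt (fun t => ((Averaging.iter av ℓ (γ t) c : SU N) : Matrix (Fin N) (Fin N) ℂ)) 0 0 :=
          hasDerivAt_coe_iter_apply_of_sameVelocity ht₀ hstδ hΓ₀0 hγ0 hray hγvel hsm (hX c hc)
        have h := hasDerivAt_iff_isLittleO.1 hvel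
        have hW : ((W ℓ c : SU N) : Matrix (Fin N) (Fin N) ℂ) = ((Averaging.iter av ℓ (γ 0) c : SU N) : Matrix (Fin N) (Fin N) ℂ) := by
          rw [hγ0, hfib ℓ le_rfl c hc]
        simp only [sub_zero, smul_zero] at h
        rw [hW]
        exact h.norm_left
      · simp only [if_neg hc]
        exact isLittleO_zero _ _
    exact IsLittleO.sum (s := (Finset.univ : Finset (PBond P ℓ))) fun c _ => hterm c
  have hdisto : dist0 =o[𝓝 (0 : ℝ)] fun t => t :=
    IsLittleO.sum (s := (Finset.univ : Finset (PBond P 0))) fun b _ =>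
      isLittleO_norm_sub_of_sameVelocity (γ₁ := γ) (γ₂ := Γ₀) (by rw [hγ0, hΓ₀0]) (hγvel b) (hray b)
  have hηo : η =o[𝓝 (0 : ℝ)] fun t => t := hDo.add hdisto
  have hη_tendsto : Tendsto (fun t => D (γ t)) (𝓝 0) (𝓝 0) := hDo.trans_tendsto tendsto_id
  -- constants and the good set
  have hκ : 0 < emlWeight P := emlWeight_pos P
  set q : ℝ := (2 / emlWeight P) ^ ℓ with hq
  have hq0 : 0 ≤ q := pow_nonneg (div_nonneg (by norm_num) hκ.le) ℓ
  have hγtend : Tendsto (fun t => coeField (γ t)) (𝓝 0) (𝓝 (coeField (γ 0))) :=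
    (hasDerivAt_pi.2 hγvel : HasDerivAt (fun t => coeField (γ t)) _ 0).continuousAt.tendsto
  have hgood : ∀ᶠ t in 𝓝 (0 : ℝ), (∀ i, i < ℓ → PlaqSmall t₀ (Averaging.iter av i (γ t))) ∧
      stokesConst P * t₀ + q * D (γ t) ≤ emlWeight P / 16 ∧ stokesConst P * t₀ + q * D (γ t) < deltaSU (Fin N) ∧
      ∀ j, j < ℓ → ∀ c ∈ Λ j, Averaging.iter av j (γ t) c = W j c := by
    have hlin : Tendsto (fun t => stokesConst P * t₀ + q * D (γ t)) (𝓝 0) (𝓝 (stokesConst P * t₀ + q * 0)) :=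
      tendsto_const_nhds.add (tendsto_const_nhds.mul hη_tendsto)
    rw [mul_zero, add_zero] at hlin
    have hsmall := eventually_plaqSmall_iter_of_tendsto ht₀ hstδ hγtend (k := ℓ) (by rw [hγ0]; exact hsm)
    exact hsmall.and ((hlin.eventually (eventually_le_nhds hst)).and ((hlin.eventually (eventually_lt_nhds hstδ)).and hγfib))
  have hgood0 : (∀ i, i < ℓ → PlaqSmall t₀ (Averaging.iter av i (γ 0))) ∧
      stokesConst P * t₀ + q * D (γ 0) ≤ emlWeight P / 16 ∧ stokesConst P * t₀ + q * D (γ 0) < deltaSU (Fin N) ∧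
      ∀ j, j < ℓ → ∀ c ∈ Λ j, Averaging.iter av j (γ 0) c = W j c := by
    have hD0 : D (γ 0) = 0 := by
      have := hη0
      simp only [hη] at this
      linarith [hD_nonneg (γ 0), hdist0_nonneg 0]
    refine ⟨fun i hi => by rw [hγ0]; exact hsm i hi, ?_, ?_, fun j hj c hc => by rw [hγ0]; exact hfib j hj.le c hc⟩
    · rw [hD0, mul_zero, add_zero]; exact hst.le
    · rw [hD0, mul_zero, add_zero]; exact hstδ
  -- the stage corrector at each good `t`
  have hcorr : ∀ t, ((∀ i, i < ℓ → PlaqSmall t₀ (Averaging.iter av i (γ t))) ∧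
      stokesConst P * t₀ + q * D (γ t) ≤ emlWeight P / 16 ∧ stokesConst P * t₀ + q * D (γ t) < deltaSU (Fin N) ∧
      ∀ j, j < ℓ → ∀ c ∈ Λ j, Averaging.iter av j (γ t) c = W j c) →
      ∃ U' : GaugeField P 0 (SU N), (∀ j, j ≤ ℓ → ∀ c ∈ Λ j, Averaging.iter av j U' c = W j c) ∧
        ∀ b, ‖((U' b : SU N) : Matrix (Fin N) (Fin N) ℂ) - ((expChart U (t • X) b : SU N) : Matrix (Fin N) (Fin N) ℂ)‖ ≤ (q + 1) * η t := by
    intro t ht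
    obtain ⟨h1, h2, h3, h4⟩ := ht
    set W' : GaugeField P ℓ (SU N) := fun c => if c ∈ Λ ℓ then W ℓ c else Averaging.iter av ℓ (γ t) c with hW'
    have hW'near : ∀ c : PBond P ℓ, ‖((W' c : SU N) : Matrix (Fin N) (Fin N) ℂ) - ((Averaging.iter av ℓ (γ t) c : SU N) : Matrix (Fin N) (Fin N) ℂ)‖ ≤ D (γ t) := by
      intro c
      by_cases hc : c ∈ Λ ℓ
      · simp only [hW', if_pos hc]
        rw [norm_sub_rev]
        exact hD_le (γ t) hc
      · simp only [hW', if_neg hc, sub_self, norm_zero]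
        exact hD_nonneg _
    have hW'off : ∀ c : PBond P ℓ, c ∉ T ℓ → W' c = Averaging.iter av ℓ (γ t) c := by
      intro c hc
      have hc' : c ∉ Λ ℓ := fun h => hc (hTΛ h)
      simp only [hW', if_neg hc']
    obtain ⟨U', hU'top, hU'off, hU'dist⟩ := exists_iter_eq_of_near_selective_SU_offTower (P := P) (N := N) ht₀.le ℓ hℓ (γ t) h1 T hT
      (D (γ t)) (hD_nonneg _) h2 h3 W' hW'near hW'off
    refine ⟨U', fun j hj c hc => ?_, fun b => ?_⟩
    · rcases Nat.lt_or_eq_of_le hj with hj' | rfl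
      · have hcT : c ∉ T j := fun h => (hTdisj j hj').le_bot ⟨h, hc⟩
        rw [hU'off j hj c hcT]
        exact h4 j hj' c hc
      · show Averaging.iter av j U' c = W j c
        rw [hU'top]
        simp only [hW', if_pos hc]
    · calc ‖((U' b : SU N) : Matrix (Fin N) (Fin N) ℂ) - ((expChart U (t • X) b : SU N) : Matrix (Fin N) (Fin N) ℂ)‖
          ≤ ‖((U' b : SU N) : Matrix (Fin N) (Fin N) ℂ) - (γ t b : Matrix (Fin N) (Fin N) ℂ)‖ +
              ‖((γ t b : SU N) : Matrix (Fin N) (Fin N) ℂ) - (Γ₀ t b : Matrix (Fin N) (Fin N) ℂ)‖ := norm_sub_le_norm_sub_add_norm_sub _ _ _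
        _ ≤ q * D (γ t) + dist0 t := add_le_add (hU'dist b) (hdist0_le t b)
        _ ≤ (q + 1) * η t := by
            have hDt := hD_nonneg (γ t)
            have hdt := hdist0_nonneg t
            show q * D (γ t) + dist0 t ≤ (q + 1) * (D (γ t) + dist0 t)
            nlinarith
  -- 35i §1
  exact exists_curve_of_corrector U X
    (fun V => ∀ j, j ≤ ℓ → ∀ c ∈ Λ j, Averaging.iter av j V c = W j c) hη_nonneg hηo hη0 (q := q + 1)
    (good := fun t => (∀ i, i < ℓ → PlaqSmall t₀ (Averaging.iter av i (γ t))) ∧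
      stokesConst P * t₀ + q * D (γ t) ≤ emlWeight P / 16 ∧ stokesConst P * t₀ + q * D (γ t) < deltaSU (Fin N) ∧
      ∀ j, j < ℓ → ∀ c ∈ Λ j, Averaging.iter av j (γ t) c = W j c) hgood hgood0 hcorr

/-- ★★★ **FIBRE CURVES WITH PRESCRIBED JOINT-KERNEL VELOCITY FOR A CHAIN-FREE CONSTRAINT FAMILY** (levels `≤ k₀ ≤ m + K`; `U` agrees with `W` on every `Λ j`; `t₀`-small
iterated averages below `k₀`; for every `ℓ ≤ k₀` a tower through `Λ ℓ`, closed downwards under `centralBond`, disjoint from the lower `Λ j`): for every JOINT-KERNEL direction `X`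
there is a curve `γ`, `γ 0 = U`, bond-wise velocity `U_b·X_b`, agreeing with `W` on every `Λ j`, `j ≤ k₀`, for `t` near `0`.  (Induction on the level with §2's stage, from the ray.)
[cite: Balaban1985Variational, (3),(5) p.278, Sect. C (47) p.285, Prop. 3 p.289, (82)–(83) p.290; Balaban1987RG1, (0.4), (0.11) p.253; Balaban1988Convergent, (2.2), (2.10)–(2.12) pp.255–256] -/
theorem exists_fibreCurve_of_chainFree {t₀ : ℝ} (ht₀ : 0 < t₀) (hst : stokesConst P * t₀ < emlWeight P / 16)
    (hstδ : stokesConst P * t₀ < deltaSU (Fin N)) {k₀ : ℕ} (hk₀ : k₀ ≤ P.m + P.K)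
    (Λ : (j : ℕ) → Set (PBond P j)) (W : (j : ℕ) → GaugeField P j (SU N)) {U : GaugeField P 0 (SU N)}
    (hsm : ∀ i, i < k₀ → PlaqSmall t₀ (Averaging.iter (fun i => blockAvg (P := P) (j := i) (expMeanLogSU (n := Fin N))) i U))
    (hfib : ∀ j, j ≤ k₀ → ∀ c ∈ Λ j, Averaging.iter (fun i => blockAvg (P := P) (j := i) (expMeanLogSU (n := Fin N))) j U c = W j c)
    (hCF : ∀ ℓ, ℓ ≤ k₀ → ∃ T : (i : ℕ) → Set (PBond P i), Λ ℓ ⊆ T ℓ ∧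
      (∀ i, i < ℓ → ∀ c : PBond P (i + 1), c ∈ T (i + 1) → centralBond c ∈ T i) ∧ ∀ j, j < ℓ → Disjoint (T j) (Λ j))
    {X : PBond P 0 → lieSU (Fin N)}
    (hX : ∀ j, j ≤ k₀ → ∀ c ∈ Λ j, HasDerivAt (fun t : ℝ => ((Averaging.iter (fun i => blockAvg (P := P) (j := i) (expMeanLogSU (n := Fin N))) j
      (expChart U (t • X)) c : SU N) : Matrix (Fin N) (Fin N) ℂ)) 0 0) :
    ∃ γ : ℝ → GaugeField P 0 (SU N), γ 0 = U ∧
      (∀ b : PBond P 0, HasDerivAt (fun t => ((γ t b : SU N) : Matrix (Fin N) (Fin N) ℂ)) ((U b : Matrix (Fin N) (Fin N) ℂ) * (X b : Matrix (Fin N) (Fin N) ℂ)) 0) ∧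
      ∀ᶠ t in 𝓝 (0 : ℝ), ∀ j, j ≤ k₀ → ∀ c ∈ Λ j, Averaging.iter (fun i => blockAvg (P := P) (j := i) (expMeanLogSU (n := Fin N))) j (γ t) c = W j c := by
  -- `Q ℓ` := a curve agreeing on the levels `< ℓ`; we prove `Q ℓ` for every `ℓ ≤ k₀ + 1`
  have key : ∀ ℓ, ℓ ≤ k₀ + 1 → ∃ γ : ℝ → GaugeField P 0 (SU N), γ 0 = U ∧
      (∀ b : PBond P 0, HasDerivAt (fun t => ((γ t b : SU N) : Matrix (Fin N) (Fin N) ℂ)) ((U b : Matrix (Fin N) (Fin N) ℂ) * (X b : Matrix (Fin N) (Fin N) ℂ)) 0) ∧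
      ∀ᶠ t in 𝓝 (0 : ℝ), ∀ j, j < ℓ → ∀ c ∈ Λ j, Averaging.iter (fun i => blockAvg (P := P) (j := i) (expMeanLogSU (n := Fin N))) j (γ t) c = W j c := by
    intro ℓ
    induction ℓ with
    | zero =>
      intro _
      refine ⟨fun t => expChart U (t • X), by simp only [zero_smul, expChart_zero], fun b => ?_, Eventually.of_forall fun t j hj => absurd hj (Nat.not_lt_zero j)⟩
      exact hasDerivAt_coe_expChart_along (U := U) (c := fun t : ℝ => t • X) (hasDerivAt_ray X) (zero_smul ℝ X) b
    | succ ℓ ih =>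
      intro hℓ
      have hℓk : ℓ ≤ k₀ := Nat.le_of_succ_le_succ hℓ
      obtain ⟨γ, hγ0, hγvel, hγfib⟩ := ih (Nat.le_succ_of_le hℓk)
      obtain ⟨T, hTΛ, hT, hTdisj⟩ := hCF ℓ hℓk
      obtain ⟨γ', h1, h2, h3⟩ := exists_fibreCurve_succ_of_chainFree_step ht₀ hst hstδ (hℓk.trans hk₀) Λ W
        (fun i hi => hsm i (lt_of_lt_of_le hi hℓk)) (fun j hj c hc => hfib j (hj.trans hℓk) c hc) hTΛ hT hTdisj (hX ℓ hℓk) hγ0 hγvel hγfib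
      exact ⟨γ', h1, h2, h3.mono fun t ht j hj c hc => ht j (Nat.le_of_lt_succ hj) c hc⟩
  obtain ⟨γ, h1, h2, h3⟩ := key (k₀ + 1) le_rfl
  exact ⟨γ, h1, h2, h3.mono fun t ht j hj c hc => ht j (Nat.lt_succ_of_le hj) c hc⟩

end Ascend

/-! ## §3  At NODE 00's objects: the multi-scale tangent and current forms for chain-free determining sets -/

section Record

variable {F : T4Family} {N : ℕ} [NeZero N]

/-- ★★★ **CURVE-CRITICAL ⇒ TANGENT-CRITICAL ON THE JOINT KERNEL FOR A CHAIN-FREE DETERMINING SET, NO CHART, NO CORRECTOR HYPOTHESIS** (NODE 00's objects; `𝐁` through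
`bondsOf`, no member above `k₀ ≤ m + K`; `U` ON the fibre with `t₀`-small iterated averages below `k₀`; `hCF`; `IsCritOnFibre F N K 𝐁 W U`): for every joint-kernel direction
`X`, `d∕dt A(U·exp(tX))∣_{t=0} = 0` — print's (82) on the multi-scale (83). [cite: Balaban1985Variational, p.277, (3),(5)–(7) p.278, (82)–(83) p.290, (141) p.299, p.300, Prop. 8 p.304; Balaban1988Convergent, (2.2), (2.10)–(2.12) pp.255–256] -/
theorem hasDerivAt_wilsonAction4_expChart_of_isCritOnFibre_chainFree {K k₀ : ℕ} (hk₀ : k₀ ≤ (F.P K).m + (F.P K).K) {𝔹 : DetSet (F.P K)}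
    (h𝔹 : ∀ j, k₀ < j → 𝔹 j = ∅) {t₀ : ℝ} (ht₀ : 0 < t₀) (hst : stokesConst (F.P K) * t₀ < emlWeight (F.P K) / 16)
    (hstδ : stokesConst (F.P K) * t₀ < deltaSU (Fin N)) {W : MSField (F.P K) (SU N)} {U : GaugeField (F.P K) 0 (SU N)}
    (hsm : ∀ i, i < k₀ → PlaqSmall t₀ (avgFamily (avOfRecord F N K) U i)) (hfib : AgreeOn 𝔹 (avgFamily (avOfRecord F N K) U) W)
    (hCF : ∀ ℓ, ℓ ≤ k₀ → ∃ T : (i : ℕ) → Set (PBond (F.P K) i), bondsOf (𝔹 ℓ) ⊆ T ℓ ∧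
      (∀ i, i < ℓ → ∀ c : PBond (F.P K) (i + 1), c ∈ T (i + 1) → centralBond c ∈ T i) ∧ ∀ j, j < ℓ → Disjoint (T j) (bondsOf (𝔹 j)))
    (hcrit : IsCritOnFibre F N K 𝔹 W U) {X : PBond (F.P K) 0 → lieSU (Fin N)}
    (hX : ∀ j, j ≤ k₀ → ∀ c ∈ bondsOf (𝔹 j), HasDerivAt
      (fun t : ℝ => ((avgFamily (avOfRecord F N K) (expChart U (t • X)) j c : SU N) : Matrix (Fin N) (Fin N) ℂ)) 0 0) :
    HasDerivAt (fun t : ℝ => wilsonAction4 (expChart U (t • X))) 0 0 := by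
  obtain ⟨γ, hγ0, hγvel, hγfib⟩ := exists_fibreCurve_of_chainFree (P := F.P K) ht₀ hst hstδ hk₀ (fun j => bondsOf (𝔹 j)) W (U := U) hsm
    (fun j _ c hc => hfib j c hc) hCF (X := X) hX
  have h₂ : ∀ b, HasDerivAt (fun t : ℝ => ((expChart U (t • X) b : SU N) : Matrix (Fin N) (Fin N) ℂ))
      ((U b : Matrix (Fin N) (Fin N) ℂ) * (X b : Matrix (Fin N) (Fin N) ℂ)) 0 :=
    hasDerivAt_coe_expChart_along (U := U) (c := fun t : ℝ => t • X) (hasDerivAt_ray X) (zero_smul ℝ X)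
  have h12 : γ 0 = (fun t : ℝ => expChart U (t • X)) 0 := by
    show γ 0 = expChart U ((0 : ℝ) • X)
    rw [hγ0, zero_smul, expChart_zero]
  have hfib' : ∀ᶠ t in 𝓝 (0 : ℝ), AgreeOn 𝔹 (avgFamily (avOfRecord F N K) (γ t)) W :=
    hγfib.mono fun t ht j c hc => by
      by_cases hj : j ≤ k₀
      · exact ht j hj c hc
      · exfalso
        rw [h𝔹 j (lt_of_not_ge hj)] at hc
        simp [bondsOf] at hc
  have hd : DifferentiableAt ℝ (fun (t : ℝ) (b : PBond (F.P K) 0) => ((γ t b : SU N) : Matrix (Fin N) (Fin N) ℂ)) 0 :=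
    (hasDerivAt_pi.2 hγvel).differentiableAt
  have ha := hasDerivAt_wilsonAction4 hγvel (fun p => hasDerivAt_coe_plaqHol hγvel p)
  have ha0 := hcrit γ hγ0 hd hfib' _ ha
  rw [ha0] at ha
  exact hasDerivAt_wilsonAction4_of_sameVelocity h12 hγvel h₂ ha

/-- The conclusion as the vanishing of the plain derivative. [cite: Balaban1985Variational, (82) p.290 (bookkeeping)] -/
theorem deriv_wilsonAction4_expChart_eq_zero_of_isCritOnFibre_chainFree {K k₀ : ℕ} (hk₀ : k₀ ≤ (F.P K).m + (F.P K).K) {𝔹 : DetSet (F.P K)}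
    (h𝔹 : ∀ j, k₀ < j → 𝔹 j = ∅) {t₀ : ℝ} (ht₀ : 0 < t₀) (hst : stokesConst (F.P K) * t₀ < emlWeight (F.P K) / 16)
    (hstδ : stokesConst (F.P K) * t₀ < deltaSU (Fin N)) {W : MSField (F.P K) (SU N)} {U : GaugeField (F.P K) 0 (SU N)}
    (hsm : ∀ i, i < k₀ → PlaqSmall t₀ (avgFamily (avOfRecord F N K) U i)) (hfib : AgreeOn 𝔹 (avgFamily (avOfRecord F N K) U) W)
    (hCF : ∀ ℓ, ℓ ≤ k₀ → ∃ T : (i : ℕ) → Set (PBond (F.P K) i), bondsOf (𝔹 ℓ) ⊆ T ℓ ∧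
      (∀ i, i < ℓ → ∀ c : PBond (F.P K) (i + 1), c ∈ T (i + 1) → centralBond c ∈ T i) ∧ ∀ j, j < ℓ → Disjoint (T j) (bondsOf (𝔹 j)))
    (hcrit : IsCritOnFibre F N K 𝔹 W U) {X : PBond (F.P K) 0 → lieSU (Fin N)}
    (hX : ∀ j, j ≤ k₀ → ∀ c ∈ bondsOf (𝔹 j), HasDerivAt
      (fun t : ℝ => ((avgFamily (avOfRecord F N K) (expChart U (t • X)) j c : SU N) : Matrix (Fin N) (Fin N) ℂ)) 0 0) :
    deriv (fun t : ℝ => wilsonAction4 (expChart U (t • X))) 0 = 0 :=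
  (hasDerivAt_wilsonAction4_expChart_of_isCritOnFibre_chainFree hk₀ h𝔹 ht₀ hst hstδ hsm hfib hCF hcrit hX).deriv

/-- ★★★ **THE MULTI-SCALE EULER–LAGRANGE EQUATION IN CURRENT FORM FOR A CHAIN-FREE DETERMINING SET**: under the same hypotheses, for every joint-kernel direction `X` and every
`η ≠ 0`, `Σ_b Re Tr(U_bX_bU_b⋆ · η·(D^{η*}_U∂U)(b)) = 0`. [cite: Balaban1985Variational, (82)–(83) p.290, (141) p.299, p.300; Balaban1985RegularSpaces, (1.1)–(1.2) p.76] -/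
theorem sum_re_trace_covDivT_eq_zero_of_isCritOnFibre_chainFree {K k₀ : ℕ} (hk₀ : k₀ ≤ (F.P K).m + (F.P K).K) {𝔹 : DetSet (F.P K)}
    (h𝔹 : ∀ j, k₀ < j → 𝔹 j = ∅) {t₀ : ℝ} (ht₀ : 0 < t₀) (hst : stokesConst (F.P K) * t₀ < emlWeight (F.P K) / 16)
    (hstδ : stokesConst (F.P K) * t₀ < deltaSU (Fin N)) {W : MSField (F.P K) (SU N)} {U : GaugeField (F.P K) 0 (SU N)}
    (hsm : ∀ i, i < k₀ → PlaqSmall t₀ (avgFamily (avOfRecord F N K) U i)) (hfib : AgreeOn 𝔹 (avgFamily (avOfRecord F N K) U) W)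
    (hCF : ∀ ℓ, ℓ ≤ k₀ → ∃ T : (i : ℕ) → Set (PBond (F.P K) i), bondsOf (𝔹 ℓ) ⊆ T ℓ ∧
      (∀ i, i < ℓ → ∀ c : PBond (F.P K) (i + 1), c ∈ T (i + 1) → centralBond c ∈ T i) ∧ ∀ j, j < ℓ → Disjoint (T j) (bondsOf (𝔹 j)))
    (hcrit : IsCritOnFibre F N K 𝔹 W U) {X : PBond (F.P K) 0 → lieSU (Fin N)}
    (hX : ∀ j, j ≤ k₀ → ∀ c ∈ bondsOf (𝔹 j), HasDerivAt
      (fun t : ℝ => ((avgFamily (avOfRecord F N K) (expChart U (t • X)) j c : SU N) : Matrix (Fin N) (Fin N) ℂ)) 0 0)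
    {η : ℝ} (hη : η ≠ 0) :
    ∑ b : PBond (F.P K) 0, (Matrix.trace ((U b : Matrix (Fin N) (Fin N) ℂ) * (X b : Matrix (Fin N) (Fin N) ℂ) * star (U b : Matrix (Fin N) (Fin N) ℂ) *
      (η • covDivT η (unitsField (toUField U)) b.dir b.src))).re = 0 :=
  sum_re_trace_covDivT_eq_zero_of_hasDerivAt_zero U X hη
    (hasDerivAt_wilsonAction4_expChart_of_isCritOnFibre_chainFree hk₀ h𝔹 ht₀ hst hstδ hsm hfib hCF hcrit hX)

/-- **CONSISTENCY: THE ONE-SCALE PIN IS CHAIN-FREE** — `atScale k` has no member below `k`, so the trivial tower `T := fun _ => univ` through `bondsOf ((atScale k) k)` is disjoint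
from the (empty) lower pins; 35c's `hasDerivAt_wilsonAction4_expChart_of_isCritOnFibre_atScale` is the special case. [cite: Balaban1988Convergent, (2.2) p.255 (bookkeeping)] -/
theorem chainFree_atScale {K : ℕ} (k : ℕ) :
    ∀ ℓ, ℓ ≤ k → ∃ T : (i : ℕ) → Set (PBond (F.P K) i), bondsOf ((atScale k : DetSet (F.P K)) ℓ) ⊆ T ℓ ∧
      (∀ i, i < ℓ → ∀ c : PBond (F.P K) (i + 1), c ∈ T (i + 1) → centralBond c ∈ T i) ∧
      ∀ j, j < ℓ → Disjoint (T j) (bondsOf ((atScale k : DetSet (F.P K)) j)) := by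
  intro ℓ hℓ
  refine ⟨fun _ => Set.univ, Set.subset_univ _, fun _ _ _ _ => Set.mem_univ _, fun j hj => ?_⟩
  have hjk : j ≠ k := fun h => absurd (h ▸ hj) (not_lt.2 hℓ)
  have hempty : bondsOf ((atScale k : DetSet (F.P K)) j) = ∅ := by
    ext b
    simp [bondsOf, atScale, hjk]
  rw [hempty]
  exact Set.disjoint_empty _

end Record

end Summit.QuantumFields.YangMills.BalabanUVNodes.N07CritMultiScaleChainFree

end
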